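import Summits.QuantumFields.BalabanUV.T4Continuum.Spine.NE1p.DressedSmallFieldLabelCountsMu
import Summits.QuantumFields.BalabanUV.T4Continuum.Support.B13StepTermLabels

/-!
# T⁴ programme, spine estimate NE1′ (node O3b/H2) — THE SECOND-STEP COUNT AND THE CORES' ENDs INDEXED BY ROW NE5's LABEL TYPE OF
# RECORD `B13StepTermLabels.InnerLabel ⟨Z₀, fam, P⟩`: N0u's label IS `⟨Gk.cubes Z₀ ∖ fam.biUnion Gk.cubes, (fam, P)⟩` (a kernel dictionary)

Cell `pub-balaban`, sub-cell `t4`, BINDER-OWNERS row NE1′; owner lineage t4-ne1p-p1 (PROVER seat P1, «RG-trajectory comparison …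
μ-uniformity through the printed small-field bounds»), generation 30; ADDITIVE — imports the owner's N0x PART 2
`Spine/NE1p/DressedSmallFieldLabelCountsMu` (p236238; → PART 1 p235732 → N0w → … → N0s p230233) and row NE5's
`Support/B13StepTermLabels` (the TERM LABELS of record: `InnerLabel`, `innerLabels`, `InnerLabel.WF`) ONLY; THEOREMS ONLY (0 def,
0 `def … : Prop`, 0 cite); nothing of N0s–N0x ∕ row NE5's modules is restated — their declarations are used BY NAME.

WHY THIS FILE ((B1b)'s INDEXING half).  The wall's (B1b) READING is «the identification of Bałaban's resummed (2.14)-terms with a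
finite core family fixed along the pencil»; its displayed residue in the owner's ENDs is `terms`∕`emb`∕`hscale` + the label shape
`hadm` (wall v1.7, C-t4r2-363 (i); memo g28 §3).  Row NE5 FIXED the term index of record at the activity level: `B13StepTermLabels.
InnerLabel D Bnd := ⟨Z₀, fam, P⟩` (the conditioning domain `Z₀ ∈ 𝐃_k`, the Mayer subfamily `fam ⊂ 𝐃_k` with union `Y₀`, the bond
set `P`; `Slots.act : R.carriers.Dom → InnerLabel … → …`, the activity `H Z := Σ_{ℓ ∈ innerLabels D k Z} act Z ℓ o h` of
`B13StepTermSocket.sum_term_termLabels`), while N0u ∕ N0x count the SECOND resummation step over labels `⟨W, (𝐃, P)⟩ : Σ _ : Finset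
CubeK, Finset Dk.Dom × Finset Bnd` (`W` = the uncovered cubes `Z₀∖Y₀`).  The typer's note of record (R-T130 (4)(a)): «N0u's labels
`⟨W,(fam,P)⟩` = `⟨cubes Z₀ ∖ ∪fam, (fam, P)⟩`».  This file makes that sentence KERNEL and indexes the owner's count and ENDs by NE5's TYPE:
* §1 `count_recordLabels_geometry` — for `terms : D.Dom → Finset (InnerLabel Dk.Dom Bnd)` whose labels satisfy, INLINE (no `Prop`
  minted), `ℓ.Z₀ = foot Z` (ONE conditioning domain per polymer — the sub-case «Z′₀ = Z, one component Z₀» of N0u), `∀ Y ∈ ℓ.fam,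
  Gk.cubes Y ⊆ Gk.cubes ℓ.Z₀` (NE5's `InnerLabel.WF` clause «Y within Z₀»), `ℓ.P ⊆ bondsOf (Gk.cubes ℓ.Z₀ ∖ ℓ.fam.biUnion Gk.cubes)`
  and `#(Gk.cubes ℓ.Z₀ ∖ ℓ.fam.biUnion Gk.cubes) ≤ 2·#ℓ.P` (print's finer constraints p. 12 «P ⊂ Y₀^{c*}» ∕ p. 18 «|P| ≥ ½M⁻⁴|Z₀∖Y₀|»,
  which NE5's d1 leaves to «zero terms»): `Σ_{ℓ ∈ terms Z} (Π_{Y∈ℓ.fam} α₆e^{−δκd_k Y}e^{−R(d_k Y+5)})·(s²t)^{#ℓ.P} ≤ e^{−Rkp·d(Z)}` —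
  N0x's `count_innerLabels_geometry` BY NAME after re-indexing along the INLINE dictionary
  `ℓ ↦ ⟨Gk.cubes ℓ.Z₀ ∖ ℓ.fam.biUnion Gk.cubes, (ℓ.fam, ℓ.P)⟩` (`Finset.sum_image`, injective at fixed `Z₀`; `fam ∈ coveringFamilies univ
  Gk.cubes (Gk.cubes Z₀ ∖ W)` because `Gk.cubes Z₀ ∖ (Gk.cubes Z₀ ∖ ∪fam) = ∪fam` — `Finset.sdiff_sdiff_self_left` + `Finset.biUnion_subset`).
* §2 **`attachedPart_locE_le_of_coresAt_pencil_recordLabels`** ∕ **`muPart_locE_le_of_coresAt_pencil_recordLabels`** = N0s §3's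
  `attachedPart_locE_le_of_coresAt_pencil_count` ∕ `muPart_locE_le_of_coresAt_pencil_count` ONCE EACH BY NAME at the core index
  `InnerLabel Dk.Dom Bnd`, `hCount` := §1 — the table pencil `h₀ + s • w` and road P1's source pencil `h₀ + s • v`.
WHAT IT DOES for (B1b) (owner's reading; nothing re-labelled): the owner's second-step count and ENDs are now indexed by NE5's label
TYPE of record; the residue of (B1b) at this index is (i) `emb`∕`hscale`∕`foot` — the identification of the scale-`k` catalogue
`Dk.Dom` with the carriers' `(b13InnerData R).innerLevel k` and of the `locE` polymer with a carrier domain (Q-NE1p-emb, the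
substrate's to name) — and (ii) «`terms Z` ⊆ NE5's `innerLabels` FILTERED by print's finer constraints; off the filter the substrate's
terms vanish» (NE5 d2's zero-terms convention) — READING.  (B3-form) `hAmp` unchanged (READING); (B3-count) at this index = §1.

PRINTED LOCI (TYPE∕CONTEXT only — [Balaban1988RGII] = CMP 116 (1988); renders `b2b-balaban-ref1/pages/1988-cmp116-rg-II-cluster/…
-p015∕p017∕p018-x2.png` read as images this generation).  p. 15 (2.14): the term carries `Π_{Y∈𝐃} ∫dt(Y) (2πi)⁻¹∮dτ(Y)∕(τ(Y)−t(Y))²`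
and `χ_{k,Y₀}(B)χ^c_{k,P}(B) exp[Σ_{Y∈𝐃} τ(Y)𝐕_k(Y,B)]` — the label is `(Z₀, 𝐃, P)`; p. 17 «For a fixed Y₀ we sum over all 𝐃
satisfying (2.2). Next, we sum over Y₀, P determining a fixed Z₀»; p. 18 «The definition of Z₀ yields |P| ≥ ½M⁻⁴|Z₀∖Y₀|, because one
bond in P may connect two cubes in Z₀∖Y₀».  NE5's own loci for the labels: `Support/B13StepTermLabels` header ([II] p. 12 (2.1)∕
(2.3), p. 14 (2.9)∕(2.13), p. 15).  Nothing here is used as a fact about Bałaban's densities.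

HONEST FRAMING.  Finite re-indexing + by-name application of N0x ∕ N0s over SHAPES; `InnerLabel` is NE5's plain DATA type, `Gk` a
`Geometry` HYPOTHESIS structure; nothing of (B1b)∕(B3) is discharged on Bałaban's densities; 0 binders instantiated on Bałaban's
(2.14) data; wall v1.7 (T4-DAG v47) does NOT move; NE1′ NOT printed, NOT proved; 0∕9; count 9 unchanged.  ABSOLUTE RULE honoured:
printed loci are TYPE∕CONTEXT only; nothing internally minted is cited; [folklore] tags on kernel lemmas only.  Rung (B)+1 on ONE
finite T⁴ — NOT infinite volume, NOT a mass gap, NOT OS on ℝ⁴, NOT Clay.  HONEST DEPENDENCY: continuum YM on T⁴ ⇐ BetaPertH ∧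
nine spine estimates (0/9 proved); BetaPertH ⇐ (D1) ∧ (D4) ∧ CAP+tail; G-an2-4 gates asym, D1 and NE2/3/4. -/
noncomputable section

namespace Summit.QuantumFields.BalabanUV.T4Continuum.NE1p.DressedSmallFieldRecordLabels

open Metric Set Complex MeasureTheory
open scoped BigOperators
open Literature.MathematicalPhysics.QuantumFieldTheory.Balaban1983to89 (LocDomainSys)
open Literature.MathematicalPhysics.QuantumFieldTheory.Balaban1983to89.B13FamilySum (coveringFamilies mem_coveringFamilies)
open Literature.MathematicalPhysics.QuantumFieldTheory.Balaban1983to89.T4OutputRate (Carriers)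
open Literature.MathematicalPhysics.QuantumFieldTheory.Balaban1983to89.B13Resummation (locE Geometry)
open Summit.QuantumFields.BalabanUV.T4Continuum.B13HistMeasurable (MeasPotFrame B13HistM)
open Summit.QuantumFields.BalabanUV.T4Continuum.B13TermParamGaussianBi (BiCore)
open Summit.QuantumFields.BalabanUV.T4Continuum.B13StepTermLabels (InnerLabel)
open Summit.QuantumFields.BalabanUV.T4Continuum.NE1p.DressedSmallFieldFamilyCount (attachedPart_locE_le_of_coresAt_pencil_count
  muPart_locE_le_of_coresAt_pencil_count)
open Summit.QuantumFields.BalabanUV.T4Continuum.NE1p.DressedSmallFieldLabelCounts (count_innerLabels_geometry)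

/-! ## §1 THE SECOND-STEP COUNT OVER NE5's LABELS `⟨Z₀, fam, P⟩` (N0x's `count_innerLabels_geometry` re-indexed along the dictionary) -/

section Count

variable {D Dk : LocDomainSys} {CubeK : Type} [DecidableEq CubeK] {Bnd : Type} [DecidableEq Bnd]

omit [DecidableEq Bnd] in
/-- **THE DICTIONARY LANDS IN N0u's ADMISSIBLE LABELS** [folklore]: for a label `⟨Z₀, fam, P⟩` with every `Y ∈ fam` inside `Z₀`
(footprints), the family `fam` covers EXACTLY the complement in `Gk.cubes Z₀` of the uncovered set `Gk.cubes Z₀ ∖ fam.biUnion Gk.cubes`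
— i.e. `fam ∈ coveringFamilies univ Gk.cubes (Gk.cubes Z₀ ∖ W)` with `W := Gk.cubes Z₀ ∖ ∪fam` (`Finset.sdiff_sdiff_self_left`). -/
theorem fam_mem_coveringFamilies_sdiff (Gk : Geometry Dk CubeK) (ℓ : InnerLabel Dk.Dom Bnd)
    (hwithin : ∀ Y ∈ ℓ.fam, Gk.cubes Y ⊆ Gk.cubes ℓ.Z₀) :
    ℓ.fam ∈ coveringFamilies Finset.univ Gk.cubes (Gk.cubes ℓ.Z₀ \ (Gk.cubes ℓ.Z₀ \ ℓ.fam.biUnion Gk.cubes)) := by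
  refine mem_coveringFamilies.2 ⟨Finset.subset_univ _, ?_⟩
  rw [Finset.sdiff_sdiff_self_left, Finset.inter_eq_right.2 (Finset.biUnion_subset.2 hwithin)]

/-- **THE SECOND-STEP COUNT OVER NE5's LABELS OF RECORD, TABLE-FREE** (kernel; N0x's `count_innerLabels_geometry` BY NAME after
re-indexing along `ℓ ↦ ⟨Gk.cubes ℓ.Z₀ ∖ ℓ.fam.biUnion Gk.cubes, (ℓ.fam, ℓ.P)⟩`, injective on the labels of one polymer since they
share `Z₀ = foot Z`): for `terms : D.Dom → Finset (InnerLabel Dk.Dom Bnd)` with `hadm` (inline: `ℓ.Z₀ = foot Z`; NE5's «Y within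
Z₀»; print's finer constraints `P ⊆ bondsOf (Z₀∖Y₀)` and `#(Z₀∖Y₀) ≤ 2·#P`), and the count binders of N0u ∕ N0x VERBATIM:
`Σ_{ℓ ∈ terms Z} (Π_{Y∈ℓ.fam} α₆e^{−δκd_k Y}e^{−R(d_k Y+5)})·(s²t)^{#ℓ.P} ≤ e^{−Rkp·d(Z)}`. [folklore] -/
theorem count_recordLabels_geometry (Gk : Geometry Dk CubeK) (foot : D.Dom → Dk.Dom)
    (hmono : ∀ Z, D.dj Z ≤ Dk.dj (foot Z)) (bondsOf : Finset CubeK → Finset Bnd) {δ κ α₆ R Rkp c₃₂ b₀ s t : ℝ} (hα₆ : 0 ≤ α₆)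
    (hκ : Gk.κ₀ + 1 ≤ δ * κ) (h229 : Real.exp 1 * Gk.K₀ * Gk.c₁ * α₆ ≤ 1) (hs0 : 0 ≤ s) (hs1 : s ≤ 1) (ht : 0 ≤ t)
    (hb₀ : ∀ W, ((bondsOf W).card : ℝ) ≤ b₀ * W.card) (hRkp : 0 ≤ Rkp)
    (hRR : Rkp ≤ R - Gk.c₁ * (Real.exp (R * c₃₂) * s * Real.exp (b₀ * t)))
    (hlink : ∀ Z, ∀ W ⊆ Gk.cubes (foot Z), ∀ Df ∈ coveringFamilies Finset.univ Gk.cubes (Gk.cubes (foot Z) \ W),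
      Dk.dj (foot Z) + 5 ≤ ∑ Y ∈ Df, (Dk.dj Y + 5) + c₃₂ * W.card)
    {terms : D.Dom → Finset (InnerLabel Dk.Dom Bnd)}
    (hadm : ∀ Z, ∀ ℓ ∈ terms Z, ℓ.Z₀ = foot Z ∧ (∀ Y ∈ ℓ.fam, Gk.cubes Y ⊆ Gk.cubes ℓ.Z₀) ∧
      ℓ.P ⊆ bondsOf (Gk.cubes ℓ.Z₀ \ ℓ.fam.biUnion Gk.cubes) ∧ (Gk.cubes ℓ.Z₀ \ ℓ.fam.biUnion Gk.cubes).card ≤ 2 * ℓ.P.card)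
    (Z : D.Dom) :
    ∑ ℓ ∈ terms Z, (∏ Y ∈ ℓ.fam, (α₆ * Real.exp (-(δ * κ * Dk.dj Y)) * Real.exp (-(R * (Dk.dj Y + 5))))) *
        (s ^ 2 * t) ^ ℓ.P.card ≤ Real.exp (-(Rkp * D.dj Z)) := by
  classical
  -- the inline dictionary and its injectivity on the labels of one polymer
  set φ : InnerLabel Dk.Dom Bnd → (Σ _ : Finset CubeK, Finset Dk.Dom × Finset Bnd) :=
    fun ℓ => ⟨Gk.cubes ℓ.Z₀ \ ℓ.fam.biUnion Gk.cubes, (ℓ.fam, ℓ.P)⟩ with hφ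
  have hinj : ∀ Z', Set.InjOn φ ↑(terms Z') := by
    intro Z' ℓ₁ h₁ ℓ₂ h₂ h
    obtain ⟨a, b, c⟩ := ℓ₁
    obtain ⟨a', b', c'⟩ := ℓ₂
    have ha : a = foot Z' := (hadm Z' _ h₁).1
    have ha' : a' = foot Z' := (hadm Z' _ h₂).1
    simp only [hφ, Sigma.mk.injEq, heq_eq_eq, Prod.mk.injEq] at h
    obtain ⟨-, hb, hc⟩ := h
    subst hb; subst hc; rw [ha, ha']
  -- the image labels are N0u-admissible
  have hadm' : ∀ Z', ∀ l ∈ (terms Z').image φ, l.1 ⊆ Gk.cubes (foot Z') ∧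
      l.2.1 ∈ coveringFamilies Finset.univ Gk.cubes (Gk.cubes (foot Z') \ l.1) ∧ l.2.2 ⊆ bondsOf l.1 ∧
      l.1.card ≤ 2 * l.2.2.card := by
    intro Z' l hl
    obtain ⟨ℓ, hℓ, rfl⟩ := Finset.mem_image.1 hl
    obtain ⟨hZ₀, hwithin, hP, hcard⟩ := hadm Z' ℓ hℓ
    refine ⟨?_, ?_, hP, hcard⟩
    · simp only [hφ, ← hZ₀]; exact Finset.sdiff_subset
    · simp only [hφ, ← hZ₀]; exact fam_mem_coveringFamilies_sdiff Gk ℓ hwithin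
  have hcount := count_innerLabels_geometry Gk foot hmono bondsOf hα₆ hκ h229 hs0 hs1 ht hb₀ hRkp hRR hlink
    (terms := fun Z' => (terms Z').image φ) hadm' Z
  rw [Finset.sum_image (hinj Z)] at hcount
  simpa only [hφ] using hcount

end Count

/-! ## §2 THE CORES' ENDs AT THE INDEX `InnerLabel Dk.Dom Bnd` (N0s §3's count ENDs ONCE each, `hCount` := §1) -/

section Ends

variable {C : Carriers} {P : MeasPotFrame C} {Op : Type*} [NormedAddCommGroup Op] [NormedSpace ℂ Op]
variable (D : LocDomainSys) {Cube : Type} [DecidableEq Cube] (G : Geometry D Cube)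
  {Dk : LocDomainSys} {CubeK : Type} [DecidableEq CubeK] {Bnd : Type} [DecidableEq Bnd] (Gk : Geometry Dk CubeK)
  {𝒴 : ℕ → InnerLabel Dk.Dom Bnd → Type*} {dom : ∀ k i, 𝒴 k i → C.Dom}
  {β : ℕ → InnerLabel Dk.Dom Bnd → Type*} [∀ k i, MeasurableSpace (β k i)]
  {α : ℕ → InnerLabel Dk.Dom Bnd → Type*} [∀ k i, NormedAddCommGroup (α k i)]
  [∀ k i, InnerProductSpace ℝ (α k i)] [∀ k i, FiniteDimensional ℝ (α k i)] [∀ k i, MeasurableSpace (α k i)]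
  [∀ k i, BorelSpace (α k i)]

open Classical in
/-- **THE ATTACHED PART FOR CORES INDEXED BY NE5's LABELS OF RECORD, THE SECOND-STEP COUNT DISCHARGED** (kernel; N0s §3's
`attachedPart_locE_le_of_coresAt_pencil_count` ONCE BY NAME at the index `InnerLabel Dk.Dom Bnd` — one core `𝔊 k ⟨Z₀, fam, P⟩ X`
per label — with the table-blind majorant `(Π_{Y∈fam} α₆e^{−δκd_k Y}e^{−R(d_k Y+5)})·(s²t)^{#P}` and `hCount` := §1's
`count_recordLabels_geometry` (`0 ≤ Rkp` from `hrate`).  Binders VERBATIM N0u's END except the index type and `hadm`'s INLINE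
dictionary form; displayed of (B1b): `hadm` (the terms of `Z` are NE5-labels conditioned at `foot Z`, admissible in print's sense),
`emb`∕`hscale`; of (B3): `hAmp`, `hlink`, the clauses.  Conclusion as N0s's. [folklore] -/
theorem attachedPart_locE_le_of_coresAt_pencil_recordLabels {Win : Set (ℕ → ℝ)}
    {ctr : ℕ → (ℕ → ℝ) → C.BgB → Op × B13HistM P} {ROp RHist R' : ℕ → ℝ}
    (𝔊 : ∀ k i, C.Dom → BiCore P (dom k i) Op (β k i) (α k i)) {mq bq N₀ : ℕ → InnerLabel Dk.Dom Bnd → C.Dom → ℝ}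
    (hroom : ∀ k, ROp k < R' k)
    (hm : ∀ k, ∀ g ∈ Win, ∀ (U : C.BgB) (X : C.Dom), C.scale X = k → ∀ i, 0 < mq k i X)
    (hN : ∀ k, ∀ g ∈ Win, ∀ (U : C.BgB) (X : C.Dom), C.scale X = k → ∀ i,
      (∀ o ∈ ball (ctr k g U).1 (R' k), AEStronglyMeasurable ((𝔊 k i X).N o) (𝔊 k i X).lam) ∧
      (∀ p, DifferentiableOn ℂ (fun o => (𝔊 k i X).N o p) (ball (ctr k g U).1 (R' k))) ∧
      (∀ o ∈ ball (ctr k g U).1 (R' k), ∀ p, ‖(𝔊 k i X).N o p‖ ≤ N₀ k i X))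
    (hq : ∀ k, ∀ g ∈ Win, ∀ (U : C.BgB) (X : C.Dom), C.scale X = k → ∀ i,
      (∀ o ∈ ball (ctr k g U).1 (R' k),
        AEStronglyMeasurable (Function.uncurry ((𝔊 k i X).q o)) ((𝔊 k i X).lam.prod volume)) ∧
      (∀ p v, DifferentiableOn ℂ (fun o => (𝔊 k i X).q o p v) (ball (ctr k g U).1 (R' k))) ∧
      (∀ o ∈ ball (ctr k g U).1 (R' k), ∀ p v, mq k i X * ‖v‖ ^ 2 - bq k i X ≤ ((𝔊 k i X).q o p v).re))
    {k : ℕ} {g : ℕ → ℝ} (hg : g ∈ Win) {U : C.BgB} {o : Op} {h₀ w : B13HistM P} {ϱ : ℝ}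
    (hO : ‖o - (ctr k g U).1‖ ≤ ROp k) (hH : ‖h₀ - (ctr k g U).2‖ + ϱ * ‖w‖ ≤ RHist k)
    {emb : D.Dom → C.Dom} (hscale : ∀ Z, C.scale (emb Z) = k)
    {terms : D.Dom → Finset (InnerLabel Dk.Dom Bnd)} {act : ℂ → D.Dom → ℂ}
    (hact : ∀ σ ∈ ball (0 : ℂ) ϱ, ∀ Z, act σ Z = ∑ i ∈ terms Z, (𝔊 k i (emb Z)).termAt o (h₀ + σ • w))
    {A₀ A₁ Rkp r₁ b₅ : ℝ} {X₀ : D.Dom} (hA₀ : 0 ≤ A₀) (hA₁ : 0 ≤ A₁) (hr₁ : 0 ≤ r₁) (hb : r₁ * 5 ≤ b₅)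
    (hrate : r₁ + 2 * G.κ₀ + 2 ≤ Rkp) (hsmall : (A₀ + ϱ * A₁) * Real.exp (b₅ + 1) * G.K₀ * G.ν * G.c₁ ≤ 1)
    (foot : D.Dom → Dk.Dom) (hmono : ∀ Z, D.dj Z ≤ Dk.dj (foot Z)) (bondsOf : Finset CubeK → Finset Bnd)
    {δ κ α₆ R c₃₂ b₀ s t : ℝ} (hα₆ : 0 ≤ α₆) (hκ : Gk.κ₀ + 1 ≤ δ * κ) (h229 : Real.exp 1 * Gk.K₀ * Gk.c₁ * α₆ ≤ 1)
    (hs0 : 0 ≤ s) (hs1 : s ≤ 1) (ht : 0 ≤ t) (hb₀ : ∀ W, ((bondsOf W).card : ℝ) ≤ b₀ * W.card)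
    (hRR : Rkp ≤ R - Gk.c₁ * (Real.exp (R * c₃₂) * s * Real.exp (b₀ * t)))
    (hlink : ∀ Z, ∀ W ⊆ Gk.cubes (foot Z), ∀ Df ∈ coveringFamilies Finset.univ Gk.cubes (Gk.cubes (foot Z) \ W),
      Dk.dj (foot Z) + 5 ≤ ∑ Y ∈ Df, (Dk.dj Y + 5) + c₃₂ * W.card)
    (hadm : ∀ Z, ∀ ℓ ∈ terms Z, ℓ.Z₀ = foot Z ∧ (∀ Y ∈ ℓ.fam, Gk.cubes Y ⊆ Gk.cubes ℓ.Z₀) ∧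
      ℓ.P ⊆ bondsOf (Gk.cubes ℓ.Z₀ \ ℓ.fam.biUnion Gk.cubes) ∧ (Gk.cubes ℓ.Z₀ \ ℓ.fam.biUnion Gk.cubes).card ≤ 2 * ℓ.P.card)
    (hAmp : ∀ Z, G.cubes Z ⊆ G.cubes X₀ → ∀ ℓ ∈ terms Z,
      (𝔊 k ℓ (emb Z)).lam.real univ * ((𝔊 k ℓ (emb Z)).wB * N₀ k ℓ (emb Z) * Real.exp (bq k ℓ (emb Z))) *
          (Real.pi / (mq k ℓ (emb Z) / 2)) ^ (Module.finrank ℝ (α k ℓ) / 2 : ℝ) *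
        Real.exp ((𝔊 k ℓ (emb Z)).N₁ * (‖h₀‖ + ϱ * ‖w‖)) ≤
      (A₀ + ϱ * A₁) * ((∏ Y ∈ ℓ.fam, (α₆ * Real.exp (-(δ * κ * Dk.dj Y)) * Real.exp (-(R * (Dk.dj Y + 5))))) *
        (s ^ 2 * t) ^ ℓ.P.card))
    (hϱ : 2 ≤ ϱ) (hϱA : A₀ ≤ ϱ * A₁) :
    ‖locE G.ι G.cubes (act 1) (G.cubes X₀) - locE G.ι G.cubes (act 0) (G.cubes X₀)‖ ≤
      4 * (Real.exp 1 * G.ν * G.c₁ * G.K₀ ^ 2) * A₁ * Real.exp (-(r₁ * D.dj X₀)) :=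
  attachedPart_locE_le_of_coresAt_pencil_count D G 𝔊 hroom hm hN hq hg hO hH hscale hact hA₀ hA₁ hr₁ hb hrate hsmall
    (fun _ ℓ => (∏ Y ∈ ℓ.fam, (α₆ * Real.exp (-(δ * κ * Dk.dj Y)) * Real.exp (-(R * (Dk.dj Y + 5))))) *
      (s ^ 2 * t) ^ ℓ.P.card) hAmp
    (fun Z _ => count_recordLabels_geometry Gk foot hmono bondsOf hα₆ hκ h229 hs0 hs1 ht hb₀ (by linarith [G.κ₀_nonneg]) hRR
      hlink hadm Z) hϱ hϱA

open Classical in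
/-- **THE μ-PART (SOURCE PENCIL `h₀ + s • v`, `‖s‖ < μ₁`) FOR CORES INDEXED BY NE5's LABELS OF RECORD, THE SECOND-STEP COUNT
DISCHARGED** (kernel; N0s §3's `muPart_locE_le_of_coresAt_pencil_count` ONCE BY NAME at the index `InnerLabel Dk.Dom Bnd`,
`hCount` := §1 — road P1's twin of the END above: the source enters `hAmp` ALONE through the radius `‖h₀‖ + μ₁‖v‖`).  For
`0 < μ₀ < μ₁`, `‖sμ‖ ≤ μ₀`: `‖E[act sμ](X₀) − E[act 0](X₀)‖ ≤ (e ν c₁ K₀²·A·e^{−r₁ d(X₀)})·μ₀∕(μ₁ − μ₀)`. [folklore] -/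
theorem muPart_locE_le_of_coresAt_pencil_recordLabels {Win : Set (ℕ → ℝ)}
    {ctr : ℕ → (ℕ → ℝ) → C.BgB → Op × B13HistM P} {ROp RHist R' : ℕ → ℝ}
    (𝔊 : ∀ k i, C.Dom → BiCore P (dom k i) Op (β k i) (α k i)) {mq bq N₀ : ℕ → InnerLabel Dk.Dom Bnd → C.Dom → ℝ}
    (hroom : ∀ k, ROp k < R' k)
    (hm : ∀ k, ∀ g ∈ Win, ∀ (U : C.BgB) (X : C.Dom), C.scale X = k → ∀ i, 0 < mq k i X)
    (hN : ∀ k, ∀ g ∈ Win, ∀ (U : C.BgB) (X : C.Dom), C.scale X = k → ∀ i,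
      (∀ o ∈ ball (ctr k g U).1 (R' k), AEStronglyMeasurable ((𝔊 k i X).N o) (𝔊 k i X).lam) ∧
      (∀ p, DifferentiableOn ℂ (fun o => (𝔊 k i X).N o p) (ball (ctr k g U).1 (R' k))) ∧
      (∀ o ∈ ball (ctr k g U).1 (R' k), ∀ p, ‖(𝔊 k i X).N o p‖ ≤ N₀ k i X))
    (hq : ∀ k, ∀ g ∈ Win, ∀ (U : C.BgB) (X : C.Dom), C.scale X = k → ∀ i,
      (∀ o ∈ ball (ctr k g U).1 (R' k),
        AEStronglyMeasurable (Function.uncurry ((𝔊 k i X).q o)) ((𝔊 k i X).lam.prod volume)) ∧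
      (∀ p v, DifferentiableOn ℂ (fun o => (𝔊 k i X).q o p v) (ball (ctr k g U).1 (R' k))) ∧
      (∀ o ∈ ball (ctr k g U).1 (R' k), ∀ p v, mq k i X * ‖v‖ ^ 2 - bq k i X ≤ ((𝔊 k i X).q o p v).re))
    {k : ℕ} {g : ℕ → ℝ} (hg : g ∈ Win) {U : C.BgB} {o : Op} {h₀ v : B13HistM P} {μ₁ : ℝ}
    (hO : ‖o - (ctr k g U).1‖ ≤ ROp k) (hH : ‖h₀ - (ctr k g U).2‖ + μ₁ * ‖v‖ ≤ RHist k)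
    {emb : D.Dom → C.Dom} (hscale : ∀ Z, C.scale (emb Z) = k)
    {terms : D.Dom → Finset (InnerLabel Dk.Dom Bnd)} {act : ℂ → D.Dom → ℂ}
    (hact : ∀ σ ∈ ball (0 : ℂ) μ₁, ∀ Z, act σ Z = ∑ i ∈ terms Z, (𝔊 k i (emb Z)).termAt o (h₀ + σ • v))
    {A Rkp r₁ b₅ μ₀ : ℝ} {X₀ : D.Dom} {sμ : ℂ} (hA : 0 ≤ A) (hr₁ : 0 ≤ r₁) (hb : r₁ * 5 ≤ b₅)
    (hrate : r₁ + 2 * G.κ₀ + 2 ≤ Rkp) (hsmall : A * Real.exp (b₅ + 1) * G.K₀ * G.ν * G.c₁ ≤ 1)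
    (foot : D.Dom → Dk.Dom) (hmono : ∀ Z, D.dj Z ≤ Dk.dj (foot Z)) (bondsOf : Finset CubeK → Finset Bnd)
    {δ κ α₆ R c₃₂ b₀ s t : ℝ} (hα₆ : 0 ≤ α₆) (hκ : Gk.κ₀ + 1 ≤ δ * κ) (h229 : Real.exp 1 * Gk.K₀ * Gk.c₁ * α₆ ≤ 1)
    (hs0 : 0 ≤ s) (hs1 : s ≤ 1) (ht : 0 ≤ t) (hb₀ : ∀ W, ((bondsOf W).card : ℝ) ≤ b₀ * W.card)
    (hRR : Rkp ≤ R - Gk.c₁ * (Real.exp (R * c₃₂) * s * Real.exp (b₀ * t)))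
    (hlink : ∀ Z, ∀ W ⊆ Gk.cubes (foot Z), ∀ Df ∈ coveringFamilies Finset.univ Gk.cubes (Gk.cubes (foot Z) \ W),
      Dk.dj (foot Z) + 5 ≤ ∑ Y ∈ Df, (Dk.dj Y + 5) + c₃₂ * W.card)
    (hadm : ∀ Z, ∀ ℓ ∈ terms Z, ℓ.Z₀ = foot Z ∧ (∀ Y ∈ ℓ.fam, Gk.cubes Y ⊆ Gk.cubes ℓ.Z₀) ∧
      ℓ.P ⊆ bondsOf (Gk.cubes ℓ.Z₀ \ ℓ.fam.biUnion Gk.cubes) ∧ (Gk.cubes ℓ.Z₀ \ ℓ.fam.biUnion Gk.cubes).card ≤ 2 * ℓ.P.card)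
    (hAmp : ∀ Z, G.cubes Z ⊆ G.cubes X₀ → ∀ ℓ ∈ terms Z,
      (𝔊 k ℓ (emb Z)).lam.real univ * ((𝔊 k ℓ (emb Z)).wB * N₀ k ℓ (emb Z) * Real.exp (bq k ℓ (emb Z))) *
          (Real.pi / (mq k ℓ (emb Z) / 2)) ^ (Module.finrank ℝ (α k ℓ) / 2 : ℝ) *
        Real.exp ((𝔊 k ℓ (emb Z)).N₁ * (‖h₀‖ + μ₁ * ‖v‖)) ≤
      A * ((∏ Y ∈ ℓ.fam, (α₆ * Real.exp (-(δ * κ * Dk.dj Y)) * Real.exp (-(R * (Dk.dj Y + 5))))) *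
        (s ^ 2 * t) ^ ℓ.P.card))
    (h0 : 0 < μ₀) (h01 : μ₀ < μ₁) (hμ : ‖sμ‖ ≤ μ₀) :
    ‖locE G.ι G.cubes (act sμ) (G.cubes X₀) - locE G.ι G.cubes (act 0) (G.cubes X₀)‖ ≤
      Real.exp 1 * G.ν * G.c₁ * G.K₀ ^ 2 * A * Real.exp (-(r₁ * D.dj X₀)) * (μ₀ / (μ₁ - μ₀)) :=
  muPart_locE_le_of_coresAt_pencil_count D G 𝔊 hroom hm hN hq hg hO hH hscale hact hA hr₁ hb hrate hsmall
    (fun _ ℓ => (∏ Y ∈ ℓ.fam, (α₆ * Real.exp (-(δ * κ * Dk.dj Y)) * Real.exp (-(R * (Dk.dj Y + 5))))) *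
      (s ^ 2 * t) ^ ℓ.P.card) hAmp
    (fun Z _ => count_recordLabels_geometry Gk foot hmono bondsOf hα₆ hκ h229 hs0 hs1 ht hb₀ (by linarith [G.κ₀_nonneg]) hRR
      hlink hadm Z) h0 h01 hμ

end Ends

end Summit.QuantumFields.BalabanUV.T4Continuum.NE1p.DressedSmallFieldRecordLabels

end
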